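import Summits.CriticalPhenomena.PercolationContinuityZ3.Theorems.Transplant.HexShadowGammaMin
import Literature.Probability.Percolation.SlabGluingSurgery
import HarnessLib

/-!
# HEXAGONAL SHADOWS XXII — towards Fact 2 of DST §2.3 on a general graph: stability of the minimal path `γ_min` under a local surgery
# (the exchange lemma), I

builds on p205010 (kernel theorem, internal audit signed; external expert review pending) — NOT used in this file.
Lane `prim-bschramm`, seat `prim-bschramm-p2` (gen 32; class C1b; memo `HOME/bschramm/P2-LATTICES.md` §117); helper file
(`--supports stmt-CriticalPhenomena-4575 --as helper`).  Slab original: `Literature/…/SlabGluingSurgery` §"Lex"/"Surgery" — there for the vertex type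
`slab 3 k` (`IsOSAP`, `pathKey`, `minPath`); here VERBATIM for an arbitrary countable vertex type `V` (`OpenSAP`, `sapKey`, `minSAP` of «HexShadowGammaMin»).
No geometry enters: this is the purely order-theoretic step "the minimality of `γ_min(ω)` … implies that `γ_min(ω^{(z)})` and `γ_min(ω)` coincide" of the
proof of Fact 2 (DST p. 7; Newman–Tassion–Wu §3.2).
* §1 the first-difference decomposition of the path order (`sapKey_lt_decomp`), `sapKey_lt_append` (a proper prefix is smaller), `sapKey_append_cons_lt`;
* §2 **`minSAP_eq_of_surgery`** — if `ω'` is obtained from `ω` by adding structure edges `Enew` (a branch attached to `γ = γ_min(ω)`) and deleting other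
  edges so that `γ` stays open, new edges join structure vertices and enter the protected set at `γ`, protected vertices are entered only from the
  structure, unprotected structure vertices off `γ` are not `ω`-joined to the sources, protected sources lie on `γ` or have large key, and the
  FORWARD-BRANCH condition (DST's "`(z,v) ≺ (z,w)`") holds, then `γ_min(ω') = γ_min(ω)` (the exchange argument: a smaller competitor is followed to its
  first structure vertex and spliced into `γ`).  Part II («MinSAPPrefix») has the rerouted-prefix form.
[cite: DuminilCopinSidoraviciusTassion2016, §2.3 (proof of Fact 2, p. 7)] [cite: NewmanTassionWu2017, §3.2 (proof of Thm. 3.9)]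
-/

noncomputable section

namespace Summit.CriticalPhenomena.PercolationContinuityZ3.Theorems.Transplant

open MeasureTheory Literature.Probability.Percolation Literature.Probability.LatticeModels SimpleGraph Filter
open scoped Classical Topology

variable {V : Type} [Countable V]

/-! ## §1 First-difference decomposition of the path order -/

/-- First-difference decomposition for path keys (`pathKey` compares the vertex keys `vKey`
lexicographically, a proper prefix being smaller; NTW 2017, §3.2). [folklore] -/
theorem sapKey_lt_decomp {l₁ l₂ : List V} (h : sapKey l₁ < sapKey l₂) :
    (∃ s : List V, s ≠ [] ∧ l₂ = l₁ ++ s) ∨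
      ∃ (p : List V) (a : V) (t₁ : List V) (b : V)
        (t₂ : List V), l₁ = p ++ a :: t₁ ∧ l₂ = p ++ b :: t₂ ∧ vtxKey V a < vtxKey V b := by
  rcases lt_decomp _ _ h with ⟨s, hs, hs'⟩ | ⟨p, a, t₁, b, t₂, h₁, h₂, hab⟩
  · rw [sapKey, sapKey, List.map_eq_append_iff] at hs'
    obtain ⟨m₁, m₂, rfl, hm₁, hm₂⟩ := hs'
    obtain rfl : m₁ = l₁ := (sapKey_injective V) hm₁
    refine Or.inl ⟨m₂, ?_, rfl⟩
    rintro rfl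
    exact hs (by simpa using hm₂.symm)
  · rw [sapKey, List.map_eq_append_iff] at h₁ h₂
    obtain ⟨p₁, q₁, rfl, hp₁, hq₁⟩ := h₁
    obtain ⟨p₂, q₂, rfl, hp₂, hq₂⟩ := h₂
    rw [List.map_eq_cons_iff] at hq₁ hq₂
    obtain ⟨a', t₁', rfl, rfl, -⟩ := hq₁
    obtain ⟨b', t₂', rfl, rfl, -⟩ := hq₂
    obtain rfl : p₁ = p₂ := (sapKey_injective V) (hp₁.trans hp₂.symm)
    exact Or.inr ⟨p₁, a', t₁', b', t₂', rfl, rfl, hab⟩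

/-- A proper prefix has a smaller key. [folklore] -/
theorem sapKey_lt_append {l s : List V} (hs : s ≠ []) :
    sapKey l < sapKey (l ++ s) := by
  simp only [sapKey, List.map_append]
  have hs' : s.map (vtxKey V) ≠ [] := by simpa using hs
  generalize s.map (vtxKey V) = M at hs'
  generalize l.map (vtxKey V) = L
  induction L with
  | nil =>
    cases M with
    | nil => exact absurd rfl hs'
    | cons x xs => exact List.Lex.nil
  | cons x xs ih => exact List.Lex.cons ih

/-- Keys are decided at the first difference. [folklore] -/
theorem sapKey_append_cons_lt {p t₁ t₂ : List V} {a b : V}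
    (hab : vtxKey V a < vtxKey V b) : sapKey (p ++ a :: t₁) < sapKey (p ++ b :: t₂) := by
  simp only [sapKey, List.map_append, List.map_cons]
  generalize p.map (vtxKey V) = P
  induction P with
  | nil => exact List.Lex.rel hab
  | cons x xs ih => exact List.Lex.cons ih

/-! ## §2 The exchange lemma -/

/-- PROVED — **stability of `γ_min` under attaching a branch** (the exchange argument behind
DST 2016, §2.3, proof of Fact 2, p. 7: "the minimality of `γ_min(ω)` … implies that
`γ_min(ω^{(z)})` and `γ_min(ω)` coincide"; here in the variant keeping `γ_min(ω)` itself).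
Setting: `γ = minPath ω S X Y`; `ω' ⊆ ω ∪ Enew`; `Sw` the structure vertices, `Wv ⊆ Sw` the
protected ones. Hypotheses: `γ` is `ω'`-open (`h1`); new edges join structure-or-`γ` vertices,
never two `γ`-vertices, and a new edge at a `γ`-vertex enters `Wv` (`h8`); `ω'`-open edges into
`Wv` come from `γ ∪ Sw` (`h2`); unprotected structure vertices off `γ` are not `ω`-joined in `S`
to `X` (`h4`); protected vertices of `X` lie on `γ` or have a key at least that of the start of
`γ` (`h5`); forward-branch condition (`h6`).
Conclusion: `minPath ω' S X Y = minPath ω S X Y`.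
[cite: DuminilCopinSidoraviciusTassion2016, §2.3, proof of Fact 2 (p. 7)] -/
theorem minSAP_eq_of_surgery {ω ω' : BondConfig V} {S X Y : Set V}
    (hS : S.Finite) (hex : ∃ l, OpenSAP ω S X Y l)
    (Enew : Set (Sym2 V)) (Wv Sw : Set V)
    (h1 : OpenSAP ω' S X Y (minSAP ω S X Y))
    (h3 : ω' ⊆ ω ∪ Enew) (hWv : Wv ⊆ Sw)
    (h8 : ∀ a b, s(a, b) ∈ Enew →
      (a ∈ minSAP ω S X Y ∨ a ∈ Sw) ∧ (b ∈ minSAP ω S X Y ∨ b ∈ Sw) ∧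
        ¬(a ∈ minSAP ω S X Y ∧ b ∈ minSAP ω S X Y) ∧
        (a ∈ minSAP ω S X Y → b ∈ Wv) ∧ (b ∈ minSAP ω S X Y → a ∈ Wv))
    (h2 : ∀ a b, s(a, b) ∈ ω' → b ∈ Wv → a ∈ minSAP ω S X Y ∨ a ∈ Sw)
    (h4 : ∀ q ∈ Sw, q ∉ Wv → q ∉ minSAP ω S X Y → ∀ x ∈ X, ω ∉ openConnIn S x q)
    (h5 : ∀ v ∈ Wv, v ∈ X → v ∈ minSAP ω S X Y ∨
      ∀ b ∈ (minSAP ω S X Y).head?, vtxKey V b ≤ vtxKey V v)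
    (h6 : ∀ (p : List V) (c d : V) (r : List V),
      minSAP ω S X Y = p ++ c :: d :: r →
        ∀ a ∈ Sw, a ∉ minSAP ω S X Y → s(c, a) ∈ ω' → vtxKey V d < vtxKey V a) :
    minSAP ω' S X Y = minSAP ω S X Y := by
  obtain ⟨hγO, hmin⟩ := minSAP_spec hS hex
  set γ := minSAP ω S X Y with hγ
  refine minSAP_eq_of_min hS h1 fun T' hT' => ?_
  by_contra hlt
  rw [not_le] at hlt
  -- bookkeeping on edges
  have hE1 : ∀ c d, s(c, d) ∈ ω' → c ∉ γ → c ∉ Sw → s(c, d) ∈ ω := by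
    intro c d hcd hc1 hc2
    rcases h3 hcd with h | h
    · exact h
    · exact absurd (h8 c d h).1 (not_or.2 ⟨hc1, hc2⟩)
  have hE2 : ∀ c d, s(c, d) ∈ ω' → c ∈ γ → d ∈ γ → s(c, d) ∈ ω := by
    intro c d hcd hc hd
    rcases h3 hcd with h | h
    · exact h
    · exact absurd ⟨hc, hd⟩ (h8 c d h).2.2.1
  have hE3 : ∀ c d, s(c, d) ∈ ω' → c ∈ γ → d ∉ Wv → s(c, d) ∈ ω := by
    intro c d hcd hc hd
    rcases h3 hcd with h | h
    · exact h
    · exact absurd ((h8 c d h).2.2.2.1 hc) hd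
  rcases sapKey_lt_decomp hlt with ⟨s, hs, hγeq⟩ | ⟨p, a, t₁, b, t₂, hT'eq, hγeq, hab⟩
  · -- `T'` is a proper prefix of `γ`: it is an `ω`-open path with smaller key
    have hT'ω : OpenSAP ω S X Y T' := by
      refine ⟨hT'.nodup, ?_, hT'.subset, hT'.ne_nil, hT'.head_mem, hT'.last_mem⟩
      have := hγO.chain
      rw [hγeq] at this
      exact (List.isChain_append.1 this).1
    have := hmin T' hT'ω
    rw [hγeq] at this
    exact absurd (sapKey_lt_append (l := T') hs) (not_lt.2 this)
  -- main case: `T' = p ++ a :: t₁`, `γ = p ++ b :: t₂`, `key a < key b`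
  have hpγ : ∀ x ∈ p, x ∈ γ := fun x hx => by rw [hγeq]; exact List.mem_append_left _ hx
  have hγnd : (p ++ b :: t₂).Nodup := hγeq ▸ hγO.nodup
  have hT'nd : (p ++ a :: t₁).Nodup := hT'eq ▸ hT'.nodup
  have hT'ch : (p ++ a :: t₁).IsChain (fun a b => s(a, b) ∈ ω' ∧ a ≠ b) := hT'eq ▸ hT'.chain
  have hγch : (p ++ b :: t₂).IsChain (fun a b => s(a, b) ∈ ω ∧ a ≠ b) := hγeq ▸ hγO.chain
  have hpch : p.IsChain (fun a b => s(a, b) ∈ ω ∧ a ≠ b) := (List.isChain_append.1 hγch).1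
  -- the junction vertex `c = p.getLast` (when `p ≠ []`): `γ = p' ++ c :: b :: t₂`
  have hJ : ∀ c, p.getLast? = some c → (s(c, a) ∈ ω' ∧ c ≠ a) ∧ c ∈ γ ∧
      ∃ p', γ = p' ++ c :: b :: t₂ := by
    intro c hc
    obtain ⟨p', rfl⟩ := List.getLast?_eq_some_iff.1 hc
    refine ⟨(List.isChain_append.1 hT'ch).2.2 c (by simp) a (by simp), hpγ c (by simp), p', ?_⟩
    rw [hγeq, List.append_assoc, List.singleton_append]
  -- elements of `a :: t₁` are not in `p`
  have hnotp : ∀ x ∈ a :: t₁, x ∉ p := by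
    intro x hx hxp
    exact (List.nodup_append.1 hT'nd).2.2 x hxp x hx rfl
  have haT' : a ∈ T' := by rw [hT'eq]; simp
  have haX : p = [] → a ∈ X := by
    rintro rfl
    have := hT'.head_mem hT'.ne_nil
    simp only [hT'eq, List.nil_append, List.head_cons] at this
    exact this
  have hγ0X : γ.head hγO.ne_nil ∈ X := hγO.head_mem hγO.ne_nil
  have hγ0X' : ∀ (L : List V) (hL : γ = L) (hne : L ≠ []), L.head hne ∈ X := by
    rintro L rfl hne
    exact hγO.head_mem hne
  have hjoinJ : ∀ c, p.getLast? = some c → ω ∈ openConnIn S (γ.head hγO.ne_nil) c :=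
    fun c hc => hγO.openConnIn_of_mem ((hJ c hc).2.1)
  -- The BRANCHING case `a ∈ Wv \ γ` contradicts `h5`/`h6` directly.
  by_cases hbr : a ∉ γ ∧ a ∈ Wv
  · obtain ⟨haγ, haW⟩ := hbr
    cases hp : p.getLast? with
    | none =>
      rw [List.getLast?_eq_none_iff] at hp
      rcases h5 a haW (haX hp) with h | h
      · exact haγ h
      · subst hp
        have hb : b ∈ γ.head? := by simp [hγeq]
        exact absurd hab (not_lt.2 (h b hb))
    | some c =>
      obtain ⟨⟨hca, -⟩, -, p', hp'⟩ := hJ c hp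
      exact absurd hab (not_lt.2 (h6 p' c b t₂ hp' a (hWv haW) haγ hca).le)
  -- Otherwise the junction edge is `ω`-open.
  have hJa : ∀ c, p.getLast? = some c → s(c, a) ∈ ω ∧ c ≠ a := by
    intro c hc
    obtain ⟨⟨hca, hne⟩, hcγ, -⟩ := hJ c hc
    refine ⟨?_, hne⟩
    by_cases haγ : a ∈ γ
    · exact hE2 c a hca hcγ haγ
    · exact hE3 c a hca hcγ fun h => hbr ⟨haγ, h⟩
  -- and `X ∋ x₀ ~ a` inside `S` by `ω`-open edges
  have hXa : ∃ x₀ ∈ X, ω ∈ openConnIn S x₀ a := by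
    cases hp : p.getLast? with
    | none =>
      rw [List.getLast?_eq_none_iff] at hp
      refine ⟨a, haX hp, ?_⟩
      rw [mem_openConnIn_iff_pathIn]
      exact PathIn.refl (hT'.subset a haT')
    | some c =>
      obtain ⟨-, hcγ, -⟩ := hJ c hp
      obtain ⟨hca, hne⟩ := hJa c hp
      refine ⟨γ.head hγO.ne_nil, hγ0X, SlabCriticality.openConnIn_trans (hjoinJ c hp) ?_⟩
      have hcS : c ∈ S := hγO.subset c hcγ
      have haS : a ∈ S := hT'.subset a haT'
      exact openConnIn_head_of_mem_chain c [a]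
        (List.isChain_cons_cons.2 ⟨⟨hca, hne⟩, List.isChain_singleton _⟩)
        (fun v hv => by
          simp only [List.mem_cons, List.not_mem_nil, or_false] at hv
          rcases hv with rfl | rfl
          · exact hcS
          · exact haS) a (by simp)
  -- Case analysis on whether `a :: t₁` meets the structure `γ ∪ Sw`.
  by_cases htouch : ∃ x ∈ a :: t₁, x ∈ γ ∨ x ∈ Sw
  swap
  · -- no touch: `T'` is `ω`-open
    push Not at htouch
    have hT'ω : OpenSAP ω S X Y T' := by
      refine ⟨hT'.nodup, ?_, hT'.subset, hT'.ne_nil, hT'.head_mem, hT'.last_mem⟩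
      rw [hT'eq, List.isChain_append]
      refine ⟨hpch, ?_, ?_⟩
      · exact (List.isChain_append.1 hT'ch).2.1.imp_of_mem_imp fun x y hx _ hxy =>
          ⟨hE1 x y hxy.1 (htouch x hx).1 (htouch x hx).2, hxy.2⟩
      · intro c hc y hy
        simp only [List.head?_cons, Option.mem_def, Option.some.injEq] at hy
        subst hy
        exact hJa c hc
    exact absurd (hmin T' hT'ω) (not_le.2 hlt)
  -- first touch `x`: `a :: t₁ = l₁ ++ x :: l₂`, `l₁` off the structure
  obtain ⟨l₁, x, l₂, hsplit, hxS1, hl₁⟩ := exists_first_split (a :: t₁) htouch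
  have hl₁' : ∀ y ∈ l₁, y ∉ γ ∧ y ∉ Sw := fun y hy => not_or.1 (hl₁ y hy)
  have hxT' : x ∈ a :: t₁ := by rw [hsplit]; simp
  -- `l₁ ++ x :: _` starts with `a`
  have hhead : ∀ m : List V, (l₁ ++ x :: m).head (by simp) = a := by
    intro m
    have h0 : (l₁ ++ x :: l₂).head (by simp) = a := by
      have : (a :: t₁).head (List.cons_ne_nil _ _) = a := rfl
      simp only [hsplit] at this
      exact this
    cases l₁ with
    | nil => simpa using h0
    | cons y ys => simpa using h0
  have hcons : ∀ m : List V, ∃ rest, l₁ ++ x :: m = a :: rest := by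
    intro m
    cases hl : l₁ with
    | nil => exact ⟨m, by simpa [hl] using hhead m⟩
    | cons z zs =>
      have : z = a := by simpa [hl] using hhead m
      exact ⟨zs ++ x :: m, by simp [this]⟩
  -- chain facts along `T' = p ++ l₁ ++ x :: l₂`
  have hT'ch2 : (l₁ ++ x :: l₂).IsChain (fun a b => s(a, b) ∈ ω' ∧ a ≠ b) := by
    have := (List.isChain_append.1 hT'ch).2.1
    rwa [hsplit] at this
  have hl₁ch : l₁.IsChain (fun a b => s(a, b) ∈ ω ∧ a ≠ b) :=
    (List.isChain_append.1 hT'ch2).1.imp_of_mem_imp fun u v hu _ huv =>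
      ⟨hE1 u v huv.1 (hl₁' u hu).1 (hl₁' u hu).2, huv.2⟩
  have hlinkx' : ∀ u, l₁.getLast? = some u → s(u, x) ∈ ω' ∧ u ≠ x := fun u hu =>
    (List.isChain_append.1 hT'ch2).2.2 u (by rw [hu]; rfl) x (by simp)
  have hlinkx : ∀ u, l₁.getLast? = some u → s(u, x) ∈ ω ∧ u ≠ x := by
    intro u hu
    have hul₁ : u ∈ l₁ := List.mem_of_getLast? hu
    exact ⟨hE1 u x (hlinkx' u hu).1 (hl₁' u hul₁).1 (hl₁' u hul₁).2, (hlinkx' u hu).2⟩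
  -- the `ω`-chain `l₁ ++ x :: m` for any `ω`-chain `x :: m`
  have hsegch : ∀ m : List V, (x :: m).IsChain (fun a b => s(a, b) ∈ ω ∧ a ≠ b) →
      (l₁ ++ x :: m).IsChain (fun a b => s(a, b) ∈ ω ∧ a ≠ b) := by
    intro m hm
    rw [List.isChain_append]
    refine ⟨hl₁ch, hm, fun u hu y hy => ?_⟩
    simp only [List.head?_cons, Option.mem_def, Option.some.injEq] at hy
    subst hy
    exact hlinkx u hu
  have hl₁S : ∀ v ∈ l₁, v ∈ S := fun v hv =>
    hT'.subset v (by rw [hT'eq, hsplit]; exact List.mem_append_right _ (List.mem_append_left _ hv))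
  have hxS : x ∈ S := hT'.subset x (by rw [hT'eq]; exact List.mem_append_right _ hxT')
  -- `a` is joined to `x` inside `S` by `ω`-open edges
  have hax : ω ∈ openConnIn S a x := by
    obtain ⟨rest, hrest⟩ := hcons []
    have hch' : (a :: rest).IsChain (fun a b => s(a, b) ∈ ω ∧ a ≠ b) :=
      hrest ▸ hsegch [] (List.isChain_singleton _)
    have hS' : ∀ v ∈ a :: rest, v ∈ S := by
      intro v hv
      rw [← hrest] at hv
      rcases List.mem_append.1 hv with h | h
      · exact hl₁S v h
      · rw [List.mem_singleton] at h
        rw [h]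
        exact hxS
    exact openConnIn_head_of_mem_chain a rest hch' hS' x (by rw [← hrest]; simp)
  by_cases hxγ : x ∈ γ
  · -- SPLICE: `x ∈ γ`, `x ∉ p`, so `b :: t₂ = q ++ x :: r`; the path `p ++ l₁ ++ x :: r`
    have hxγ' : x ∈ b :: t₂ := by
      have := hxγ
      rw [hγeq, List.mem_append] at this
      exact this.resolve_left (hnotp x hxT')
    obtain ⟨q, r, hqr⟩ := List.append_of_mem hxγ'
    have hxr_sub : ∀ v ∈ x :: r, v ∈ γ := fun v hv => by
      rw [hγeq, hqr]; exact List.mem_append_right _ (List.mem_append_right _ hv)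
    have hxr : (x :: r).IsChain (fun a b => s(a, b) ∈ ω ∧ a ≠ b) := by
      have := (List.isChain_append.1 hγch).2.1
      rw [hqr] at this
      exact (List.isChain_append.1 this).2.1
    obtain ⟨rest, hrest⟩ := hcons r
    have hsp : OpenSAP ω S X Y (p ++ a :: rest) := by
      rw [← hrest]
      refine ⟨?_, ?_, ?_, by simp, ?_, ?_⟩
      · -- nodup
        rw [List.nodup_append]
        refine ⟨(List.nodup_append.1 hγnd).1, ?_, ?_⟩
        · rw [List.nodup_append]
          refine ⟨?_, ?_, ?_⟩
          · have : (l₁ ++ x :: l₂).Nodup := hsplit ▸ (List.nodup_append.1 hT'nd).2.1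
            exact (List.nodup_append.1 this).1
          · have : (q ++ x :: r).Nodup := hqr ▸ (List.nodup_append.1 hγnd).2.1
            exact (List.nodup_append.1 this).2.1
          · intro u hu v hv huv
            subst huv
            exact (hl₁' u hu).1 (hxr_sub u hv)
        · intro u hu v hv huv
          subst huv
          rcases List.mem_append.1 hv with h | h
          · exact hnotp u (by rw [hsplit]; exact List.mem_append_left _ h) hu
          · have : (p ++ (q ++ x :: r)).Nodup := hqr ▸ hγnd
            exact (List.nodup_append.1 this).2.2 u hu u (List.mem_append_right _ h) rfl
      · -- chain
        rw [List.isChain_append]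
        refine ⟨hpch, hsegch r hxr, ?_⟩
        intro c hc y hy
        rw [hrest] at hy
        simp only [List.head?_cons, Option.mem_def, Option.some.injEq] at hy
        subst hy
        exact hJa c hc
      · -- subset
        intro v hv
        rcases List.mem_append.1 hv with h | h
        · exact hγO.subset v (hpγ v h)
        · rcases List.mem_append.1 h with h' | h'
          · exact hl₁S v h'
          · exact hγO.subset v (hxr_sub v h')
      · -- head
        intro hne
        by_cases hp : p = []
        · subst hp
          simp only [List.nil_append, hrest, List.head_cons]
          exact haX rfl
        · obtain ⟨y, ys, rfl⟩ := List.exists_cons_of_ne_nil hp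
          have := hγ0X' _ hγeq (by simp)
          simp only [List.cons_append, List.head_cons] at this ⊢
          exact this
      · -- last
        intro hne
        have h1 : (p ++ (l₁ ++ x :: r)).getLast hne = (x :: r).getLast (List.cons_ne_nil _ _) := by
          rw [List.getLast_append_of_ne_nil _ (by simp)]
          exact List.getLast_append_of_ne_nil _ (List.cons_ne_nil _ _)
        have h2 : γ.getLast hγO.ne_nil = (x :: r).getLast (List.cons_ne_nil _ _) := by
          have : γ = (p ++ q) ++ x :: r := by rw [hγeq, hqr, List.append_assoc]
          rw [List.getLast_congr _ (by simp) this]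
          exact List.getLast_append_of_ne_nil _ (List.cons_ne_nil _ _)
        rw [h1, ← h2]
        exact hγO.last_mem hγO.ne_nil
    have hkey : sapKey (p ++ a :: rest) < sapKey γ := by
      rw [hγeq]
      exact sapKey_append_cons_lt hab
    exact absurd (hmin _ hsp) (not_le.2 hkey)
  · -- `x ∈ Sw \ γ`
    have hxSw : x ∈ Sw := hxS1.resolve_left hxγ
    by_cases hxW : x ∈ Wv
    · -- entering a protected vertex from outside the structure: impossible by `h2`
      cases hl : l₁.getLast? with
      | none =>
        rw [List.getLast?_eq_none_iff] at hl
        have hxa : x = a := by simpa [hl] using hhead l₂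
        subst hxa
        exact hbr ⟨hxγ, hxW⟩
      | some u =>
        have hul₁ : u ∈ l₁ := List.mem_of_getLast? hl
        rcases h2 u x (hlinkx' u hl).1 hxW with h | h
        · exact (hl₁' u hul₁).1 h
        · exact (hl₁' u hul₁).2 h
    · obtain ⟨x₀, hx₀X, hx₀⟩ := hXa
      exact h4 x hxSw hxW hxγ x₀ hx₀X (SlabCriticality.openConnIn_trans hx₀ hax)

end Summit.CriticalPhenomena.PercolationContinuityZ3.Theorems.Transplant

end
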